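import Mathlib

/-!
# Seed checker C5–C8, v31 — theta-cover test (T1), pair collision (T2), refined `Ext²` floor (T4)

Cell `pub-hsemireg`, seat `hsemireg-c5c8-1`, generation 31.  Companion memo:
`Cruxes/BlochSeedDiscOne/SEED-CHECKER-C5C8-c5c8-1-g31.md`; scripts `g31/code/thetacover.py`,
`g31/code/extfloor.py`; data `g31/out/thetacover-toyPresB.json`, `g31/out/extfloor-toyPresB.json`.

HONEST FRAMING.  Nothing in this file is proved toward `HC`, `HC_CM`, `HC_AV`, ladder rung №4,
`stmt-26512`, `stmt-18881` (`BlochSeedDiscOne`) or `H2`.  The seat produces evidence and typed files,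
not rungs.  This module is a Mathlib-only record of the three COMBINATORIAL / ARITHMETIC cores behind
the g31 verdict on the fully-live twisted-apex family of the toy presentation `toyPresB`
(`U2-TORUS-TOY-presentation-h4-variantB-top40-bot8.json`, sha16 `5768bd6a0f7ae530`):

* §1–§3 (T1, theta cover).  A product-theta translate `Θ_p + t` on a product of four curves misses a
  point `u` iff no coordinate of `u` hits the translated component; a family of translates by the
  vertices `S` of the half-period cube `{a,b}^4` has EMPTY common intersection iff `S` is the whole
  cube (§2).  The 2-torsion shift map `y : F = (Λ/ΣΛ_s)^ ≅ (ℤ/2)^4 → {0,ε}^4` of toyPresB is read off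
  `thetacover-toyPresB.json: y_basis_images = 3333,0333,0033,0003` as the unitriangular matrix
  `yMat` (§3, the same for all 32 P-letters); it is a bijection, so a fully-live class family `R ⊆ F`
  is base-point free iff `R = F`: the number of twist classes is forced to be `r = 16`.
* §4 (T2, pair collision).  If two letter kernels span, `K ⊔ K' = ⊤`, any two cosets meet; this is
  the group-theoretic core of "every class needs at least two apex copies" (`c_j ≥ 2`).
* §5 (T4, refined floor).  With `U2 c = min (24c²) (192c)`, `U1 c = min (8c²) (128c)` the per-class
  rank budgets of `d₁^{0,2}`, `d₁^{0,1}` (the `24 = 28 − 4` is the universal kernel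
  `e_{2m} ∧ e_{2m+1}` of every `Λ² r_s`; the `168 = 192 − 24`, `120 = 128 − 8` are the scalar classes
  `ω·id`, always `d₁`-closed; `7680`, `5120` the codomain dimensions), the floor
  `Φ(c,B) = 28(64 + B + Σ c_j²) + 5120 − min(ΣU2 + 168, 7680) − min(ΣU1 + 120, 5120)`
  bounds `dim Ext²(E,E)` from below for EVERY member of the family (any number `r` of classes of
  sizes `c_j ≥ 1`, `Σ c_j = 40`, bottom split with `Σ b_i² = B ≥ 8`), with equality for generic
  letter twists (certified mod 10009 in `extfloor-toyPresB.json`).  We prove here, by two pointwise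
  linear majorants and NO enumeration, `5600 ≤ Φ(c,B)` for all such shapes (true minimum `5624` at
  `(8,8,8,8,7,1)`, exhibited), `6272 ≤ Φ` on the T1∧T2 shapes (true minimum `6304` at
  `(8,4,2^14)`), hence `Φ > 5572 = sheafDoorBudget_window` (the door of record,
  `SeedChecker.sheafDoorBudget_window` in `SeedCheckerKit.lean` §9.3): the whole fully-live family is
  WINDOW-DEAD.  At the all-`q` budget `8008` the count is silent (`Φ ≤ 6688 < 8008` on the admissible
  shapes with eight bottom classes).  Thinned (not fully-live) patterns are NOT covered.

Hygiene: `import Mathlib` only; every proof closed (kernel `decide` for the finite certificates);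
the MINT A5 cell hygiene rules are observed (no new type-class declarations, no syntax extensions, no
unchecked or unsafe shortcuts).
-/

set_option linter.dupNamespace false

namespace Summit.HodgeConjecture.HodgeConjecture.Cruxes.BlochSeedDiscOne.SeedCheckerThetaCover

open Finset

/-! ## §1  Product-theta translates and the transversal criterion -/

section ThetaCover

variable {ι α : Type*}

/-- The translate by `t` of the product theta divisor through `p`: the points `u` of the product
having SOME coordinate `k` on the translated component `u k = p k + t k`. -/
def prodTheta [Add α] (p t : ι → α) : Set (ι → α) := {u | ∃ k, u k = p k + t k}

theorem mem_prodTheta [Add α] {p t u : ι → α} :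
    u ∈ prodTheta p t ↔ ∃ k, u k = p k + t k := Iff.rfl

/-- A family of translates `{Θ_p + t : t ∈ S}` has a common point iff the shift set `S` admits a
"transversal" `c`: every `t ∈ S` agrees with `c` in some coordinate. -/
theorem biInter_prodTheta_nonempty_iff [AddGroup α] (p : ι → α) (S : Set (ι → α)) :
    (⋂ t ∈ S, prodTheta p t).Nonempty ↔ ∃ c : ι → α, ∀ t ∈ S, ∃ k, t k = c k := by
  constructor
  · rintro ⟨u, hu⟩
    refine ⟨fun k => -p k + u k, fun t ht => ?_⟩
    obtain ⟨k, hk⟩ := (mem_prodTheta).1 (Set.mem_iInter₂.1 hu t ht)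
    exact ⟨k, by show t k = -p k + u k; rw [hk, neg_add_cancel_left]⟩
  · rintro ⟨c, hc⟩
    refine ⟨fun k => p k + c k, Set.mem_iInter₂.2 fun t ht => ?_⟩
    obtain ⟨k, hk⟩ := hc t ht
    exact (mem_prodTheta).2 ⟨k, by rw [hk]⟩

/-! ## §2  The cube lemma: half-period shift families -/

/-- The vertex set of the "cube" `{a, b}^ι` inside `ι → α`. -/
def cube (a b : α) : Set (ι → α) := {t | ∀ k, t k = a ∨ t k = b}

theorem mem_cube {a b : α} {t : ι → α} : t ∈ cube a b ↔ ∀ k, t k = a ∨ t k = b := Iff.rfl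

/-- For shift sets inside the cube `{a,b}^ι` (`a ≠ b`): a transversal exists iff the shift set is
NOT the whole cube (the missing vertex's antipode is a transversal; conversely the antipode of a
transversal is a cube vertex with no agreeing coordinate). -/
theorem exists_transversal_iff_not_cube_subset {a b : α} (hab : a ≠ b) {S : Set (ι → α)}
    (hS : S ⊆ cube a b) :
    (∃ c : ι → α, ∀ t ∈ S, ∃ k, t k = c k) ↔ ¬ cube a b ⊆ S := by
  classical
  constructor
  · rintro ⟨c, hc⟩ hsub
    have ht₀ : (fun k => if c k = a then b else a) ∈ (cube a b : Set (ι → α)) := by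
      intro k
      by_cases h : c k = a
      · exact Or.inr (if_pos h)
      · exact Or.inl (if_neg h)
    obtain ⟨k, hk⟩ := hc _ (hsub ht₀)
    by_cases h : c k = a
    · exact hab (h.symm.trans (hk.symm.trans (if_pos h)))
    · exact h (hk.symm.trans (if_neg h))
  · intro hns
    obtain ⟨t₀, ht₀, ht₀S⟩ := Set.not_subset.1 hns
    refine ⟨fun k => if t₀ k = a then b else a, fun t ht => ?_⟩
    have hne : t ≠ t₀ := fun h => ht₀S (h ▸ ht)
    obtain ⟨k, hk⟩ := Function.ne_iff.1 hne
    refine ⟨k, ?_⟩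
    show t k = (if t₀ k = a then b else a)
    rcases ht₀ k with h0 | h0 <;> rcases hS ht k with h1 | h1
    · exact absurd (h1.trans h0.symm) hk
    · rw [h1, h0, if_pos rfl]
    · rw [h1, h0, if_neg (fun h => hab h.symm)]
    · exact absurd (h1.trans h0.symm) hk

/-- T1 core.  If the shifts of a class family are the images of an injective map `y` from the
character group `F` ONTO the cube vertices, the translates indexed by `R ⊆ F` have empty common
intersection (no base point) iff `R` is all of `F`. -/
theorem biInter_prodTheta_eq_empty_iff [AddGroup α] {a b : α} (hab : a ≠ b) (p : ι → α)
    {F : Type*} (y : F → ι → α) (hy : ∀ f, y f ∈ (cube a b : Set (ι → α)))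
    (hsurj : ∀ t ∈ (cube a b : Set (ι → α)), ∃ f, y f = t) (hinj : Function.Injective y)
    (R : Set F) :
    (⋂ f ∈ R, prodTheta p (y f)) = ∅ ↔ R = Set.univ := by
  have key : (⋂ f ∈ R, prodTheta p (y f)).Nonempty ↔ ¬ cube a b ⊆ y '' R := by
    rw [← Set.biInter_image, biInter_prodTheta_nonempty_iff]
    exact exists_transversal_iff_not_cube_subset hab (by rintro _ ⟨f, -, rfl⟩; exact hy f)
  rw [← Set.not_nonempty_iff_eq_empty, key, not_not]
  constructor
  · intro h
    ext f
    simp only [Set.mem_univ, iff_true]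
    obtain ⟨f', hf', e⟩ := h (hy f)
    exact hinj e ▸ hf'
  · rintro rfl t ht
    obtain ⟨f, rfl⟩ := hsurj t ht
    exact ⟨f, Set.mem_univ _, rfl⟩

end ThetaCover

/-! ## §3  The `GF(2)` certificate of toyPresB -/

section ToyPresB

/-- The 2-torsion shift map of toyPresB on the basis `φ₀..φ₃` of `F = (Λ/ΣΛ_s)^ ≅ (ℤ/2)^4`
(`thetacover-toyPresB.json: y_basis_images = 3333, 0333, 0033, 0003`, identical for all 32
P-letters): row `m` = cube coordinates of `y(φ_m)`, entry `1` = the half period. -/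
def yMat : Matrix (Fin 4) (Fin 4) (ZMod 2) := !![1, 1, 1, 1; 0, 1, 1, 1; 0, 0, 1, 1; 0, 0, 0, 1]

/-- Its inverse over `GF(2)`. -/
def yInv : Matrix (Fin 4) (Fin 4) (ZMod 2) := !![1, 1, 0, 0; 0, 1, 1, 0; 0, 0, 1, 1; 0, 0, 0, 1]

theorem yMat_mul_yInv : yMat * yInv = 1 := by decide

theorem yInv_mul_yMat : yInv * yMat = 1 := by decide

theorem isUnit_yMat : IsUnit yMat := ⟨⟨yMat, yInv, yMat_mul_yInv, yInv_mul_yMat⟩, rfl⟩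

theorem yMat_vecMul_injective : Function.Injective fun v : Fin 4 → ZMod 2 => Matrix.vecMul v yMat :=
  Matrix.vecMul_injective_of_isUnit isUnit_yMat

theorem zmod2_eq_zero_or_one (x : ZMod 2) : x = 0 ∨ x = 1 := by
  fin_cases x
  · exact Or.inl rfl
  · exact Or.inr rfl

variable {α : Type*}

/-- The theta shift attached to the character with coefficient vector `v`: coordinate `k` is the
half period `e` where `(v ᵥ* yMat) k = 1`, else `0`. -/
def shift [Zero α] (e : α) (v : Fin 4 → ZMod 2) : Fin 4 → α :=
  fun k => if Matrix.vecMul v yMat k = 1 then e else 0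

theorem shift_mem_cube [Zero α] (e : α) (v : Fin 4 → ZMod 2) :
    shift e v ∈ (cube 0 e : Set (Fin 4 → α)) := by
  intro k
  by_cases h : Matrix.vecMul v yMat k = 1
  · exact Or.inr (if_pos h)
  · exact Or.inl (if_neg h)

theorem shift_injective [Zero α] {e : α} (he : e ≠ 0) :
    Function.Injective (shift e : (Fin 4 → ZMod 2) → Fin 4 → α) := by
  intro v w hvw
  apply yMat_vecMul_injective
  funext k
  show Matrix.vecMul v yMat k = Matrix.vecMul w yMat k
  have hk := congrFun hvw k
  simp only [shift] at hk
  rcases zmod2_eq_zero_or_one (Matrix.vecMul v yMat k) with hv | hv <;>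
    rcases zmod2_eq_zero_or_one (Matrix.vecMul w yMat k) with hw | hw
  · rw [hv, hw]
  · exfalso
    rw [hv, hw, if_neg (by decide), if_pos rfl] at hk
    exact he hk.symm
  · exfalso
    rw [hv, hw, if_pos rfl, if_neg (by decide)] at hk
    exact he hk
  · rw [hv, hw]

theorem shift_surjective_cube [Zero α] {e : α} (he : e ≠ 0) :
    ∀ t ∈ (cube 0 e : Set (Fin 4 → α)), ∃ v, shift e v = t := by
  classical
  intro t ht
  refine ⟨Matrix.vecMul (fun k => if t k = e then (1 : ZMod 2) else 0) yInv, ?_⟩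
  funext k
  simp only [shift, Matrix.vecMul_vecMul, yInv_mul_yMat, Matrix.vecMul_one]
  rcases ht k with h0 | h0
  · rw [h0, if_neg he.symm, if_neg (by decide)]
  · rw [h0, if_pos rfl, if_pos rfl]

/-- T1 for toyPresB.  In a product of four groups with a chosen non-zero half period `e`, the
theta translates attached to a class family `R ⊆ F = (ℤ/2)^4` have no common point iff `R = F`:
a base-point-free fully-live pattern uses ALL sixteen twist classes. -/
theorem toyPresB_thetaCover_iff [AddGroup α] {e : α} (he : e ≠ 0) (p : Fin 4 → α)
    (R : Set (Fin 4 → ZMod 2)) :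
    (⋂ v ∈ R, prodTheta p (shift e v)) = ∅ ↔ R = Set.univ :=
  biInter_prodTheta_eq_empty_iff (a := (0 : α)) (b := e) (fun h => he h.symm) p (shift e)
    (shift_mem_cube e) (shift_surjective_cube he) (shift_injective he) R

/-- … and `F` has sixteen elements: the class count of a fully-live base-point-free pattern is
`r = 16`. -/
theorem card_F : Fintype.card (Fin 4 → ZMod 2) = 16 := by
  rw [Fintype.card_fun, ZMod.card, Fintype.card_fin]; rfl

end ToyPresB

/-! ## §4  Pair collision (T2): spanning kernels force cosets to meet -/

section PairCollision

/-- If two subgroups span, `K ⊔ K' = ⊤`, then every `K`-coset meets every `K'`-coset.  For a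
spanning pair of letters `s, s'` live in the same class this puts a common point on their theta
translates unless they sit on different apex copies — whence `c_j ≥ 2` (memo §3). -/
theorem cosets_meet_of_sup_eq_top {G : Type*} [AddCommGroup G] {K K' : AddSubgroup G}
    (h : K ⊔ K' = ⊤) (x x' : G) : ∃ g : G, g - x ∈ K ∧ g - x' ∈ K' := by
  have hx : x' - x ∈ K ⊔ K' := h ▸ AddSubgroup.mem_top _
  obtain ⟨k, hk, k', hk', hsum⟩ := AddSubgroup.mem_sup.1 hx
  refine ⟨x + k, by simpa using hk, ?_⟩
  have e1 : x + k - x' = -k' := by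
    have e2 : x' = x + (k + k') := by rw [hsum]; abel
    rw [e2]; abel
  rw [e1]
  exact K'.neg_mem hk'

/-- Two letters that must occupy different copies of a class of size `c` give `2 ≤ c`. -/
theorem two_le_of_injective {c : ℕ} (f : Fin 2 → Fin c) (hf : Function.Injective f) : 2 ≤ c := by
  simpa using Fintype.card_le_of_injective f hf

end PairCollision

/-! ## §5  The refined `Ext²` floor (T4) -/

section Floor

/-- Rank budget of one class of size `c` in `d₁^{0,2}`: `c · min(24c, 192)`. -/
def U2 (c : ℤ) : ℤ := min (24 * c ^ 2) (192 * c)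

/-- Rank budget of one class of size `c` in `d₁^{0,1}`: `c · min(8c, 128)`. -/
def U1 (c : ℤ) : ℤ := min (8 * c ^ 2) (128 * c)

/-- The loss of one class: `U2 + U1 − 28c²` (how much a class of size `c` lowers the floor). -/
def loss (c : ℤ) : ℤ := U2 c + U1 c - 28 * c ^ 2

/-- The refined floor `Φ(c, B)` for `r` fully-live classes of sizes `c` and bottom split with
`Σ bᵢ² = B`:  `e₁(0,2) + e₁(1,1) − [rank bound of d₁^{0,2}] − [rank bound of d₁^{0,1}]`, where
`e₁(0,2) = 28 (64 + B + Σ c_j²)`, `e₁(1,1) = 5120`, and the two rank bounds are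
`min (Σ U2 + 168) 7680` and `min (Σ U1 + 120) 5120` (memo §4). -/
def Phi {r : ℕ} (c : Fin r → ℤ) (B : ℤ) : ℤ :=
  28 * (64 + B + ∑ j, c j ^ 2) + 5120 - min (∑ j, U2 (c j) + 168) 7680
    - min (∑ j, U1 (c j) + 120) 5120

theorem U2_le_sq (c : ℤ) : U2 c ≤ 24 * c ^ 2 := min_le_left _ _
theorem U2_le_lin (c : ℤ) : U2 c ≤ 192 * c := min_le_right _ _
theorem U1_le_sq (c : ℤ) : U1 c ≤ 8 * c ^ 2 := min_le_left _ _
theorem U1_le_lin (c : ℤ) : U1 c ≤ 128 * c := min_le_right _ _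

/-- Pointwise linear majorant of the loss on `c ≥ 1` (tight at `c = 1` and `c = 8`). -/
theorem loss_le (c : ℤ) (hc : 1 ≤ c) : loss c ≤ 36 * c - 32 := by
  unfold loss
  have h1 := U2_le_sq c
  have h2 := U2_le_lin c
  have h3 := U1_le_sq c
  rcases le_or_gt c 8 with h8 | h8
  · nlinarith [mul_nonneg (sub_nonneg.2 hc) (sub_nonneg.2 h8)]
  · nlinarith [mul_nonneg (sub_nonneg.2 h8.le) (show (0 : ℤ) ≤ 20 * c + 4 by linarith)]

/-- Pointwise linear majorant of the loss on `c ≥ 2` (tight at `c = 2` and `c = 8`). -/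
theorem loss_le_two (c : ℤ) (hc : 2 ≤ c) : loss c ≤ 40 * c - 64 := by
  unfold loss
  have h1 := U2_le_sq c
  have h2 := U2_le_lin c
  have h3 := U1_le_sq c
  rcases le_or_gt c 8 with h8 | h8
  · nlinarith [mul_nonneg (sub_nonneg.2 hc) (sub_nonneg.2 h8)]
  · nlinarith [mul_nonneg (sub_nonneg.2 h8.le) (show (0 : ℤ) ≤ 20 * c + 8 by linarith)]

/-- Tangent line of `c²` at `c = 8`. -/
theorem sq_ge_tangent (c : ℤ) : 16 * c - 64 ≤ c ^ 2 := by nlinarith [sq_nonneg (c - 8)]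

theorem sum_loss_eq {r : ℕ} (c : Fin r → ℤ) :
    ∑ j, loss (c j) = ∑ j, U2 (c j) + ∑ j, U1 (c j) - 28 * ∑ j, c j ^ 2 := by
  simp only [loss, Finset.sum_sub_distrib, Finset.sum_add_distrib, Finset.mul_sum]

theorem sum_affine {r : ℕ} (c : Fin r → ℤ) (u v : ℤ) :
    ∑ j, (u * c j - v) = u * ∑ j, c j - v * r := by
  simp only [Finset.sum_sub_distrib, Finset.mul_sum, Finset.sum_const, Finset.card_univ,
    Fintype.card_fin]
  ring

/-- Lower bound dropping both caps: `Φ ≥ 6624 + 28B − Σ loss`. -/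
theorem Phi_ge_uncapped {r : ℕ} (c : Fin r → ℤ) (B : ℤ) :
    6624 + 28 * B - ∑ j, loss (c j) ≤ Phi c B := by
  unfold Phi
  have h1 := min_le_left (∑ j, U2 (c j) + 168) 7680
  have h2 := min_le_left (∑ j, U1 (c j) + 120) 5120
  rw [sum_loss_eq]
  linarith

/-- Lower bound saturating the `q = 2` cap: `Φ ≥ 28B − 888 + 20 Σ c²`. -/
theorem Phi_ge_capped {r : ℕ} (c : Fin r → ℤ) (B : ℤ) :
    28 * B - 888 + 20 * ∑ j, c j ^ 2 ≤ Phi c B := by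
  unfold Phi
  have h1 := min_le_right (∑ j, U2 (c j) + 168) 7680
  have h2 := min_le_left (∑ j, U1 (c j) + 120) 5120
  have h3 : ∑ j, U1 (c j) ≤ ∑ j, 8 * c j ^ 2 := Finset.sum_le_sum fun j _ => U1_le_sq (c j)
  rw [← Finset.mul_sum] at h3
  linarith

/-- Six or more classes: the uncapped bound and the `c ≥ 1` majorant give `Φ ≥ 5408 + 32 r ≥ 5600`. -/
theorem Phi_ge_of_six_le {r : ℕ} (c : Fin r → ℤ) (B : ℤ) (hc : ∀ j, 1 ≤ c j)
    (hsum : ∑ j, c j = 40) (hB : 8 ≤ B) (hr : 6 ≤ r) : 5600 ≤ Phi c B := by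
  have h0 := Phi_ge_uncapped c B
  have h1 : ∑ j, loss (c j) ≤ ∑ j, (36 * c j - 32) :=
    Finset.sum_le_sum fun j _ => loss_le (c j) (hc j)
  rw [sum_affine, hsum] at h1
  have hr' : (6 : ℤ) ≤ (r : ℤ) := by exact_mod_cast hr
  linarith

/-- At most five classes: the capped bound and the tangent line give `Σ c² ≥ 320`, `Φ ≥ 5736`. -/
theorem Phi_ge_of_le_five {r : ℕ} (c : Fin r → ℤ) (B : ℤ)
    (hsum : ∑ j, c j = 40) (hB : 8 ≤ B) (hr : r ≤ 5) : 5736 ≤ Phi c B := by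
  have h0 := Phi_ge_capped c B
  have h1 : ∑ j, (16 * c j - 64) ≤ ∑ j, c j ^ 2 :=
    Finset.sum_le_sum fun j _ => sq_ge_tangent (c j)
  rw [sum_affine, hsum] at h1
  have hr' : (r : ℤ) ≤ 5 := by exact_mod_cast hr
  linarith

/-- MAIN (T4, all shapes).  For every fully-live shape — any number `r` of classes of sizes
`c_j ≥ 1` with `Σ c_j = 40` and any bottom split (`B = Σ bᵢ² ≥ 8`) — the refined floor is at least
`5600` (the true minimum is `5624`, see `Phi_min_witness`). -/
theorem Phi_ge (r : ℕ) (c : Fin r → ℤ) (B : ℤ) (hc : ∀ j, 1 ≤ c j) (hsum : ∑ j, c j = 40)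
    (hB : 8 ≤ B) : 5600 ≤ Phi c B := by
  rcases le_or_gt r 5 with hr | hr
  · exact le_trans (by norm_num) (Phi_ge_of_le_five c B hsum hB hr)
  · exact Phi_ge_of_six_le c B hc hsum hB hr

/-- Hence the whole family is dead at the window budget `5572` of the sheaf door
(`SeedChecker.sheafDoorBudget_window : sheafDoorBudget {0,1,2,3} = 5572`, SeedCheckerKit §9.3). -/
theorem window_dead (r : ℕ) (c : Fin r → ℤ) (B : ℤ) (hc : ∀ j, 1 ≤ c j) (hsum : ∑ j, c j = 40)
    (hB : 8 ≤ B) : 5572 < Phi c B :=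
  lt_of_lt_of_le (by norm_num) (Phi_ge r c B hc hsum hB)

/-- The T1 ∧ T2 shapes (sixteen classes, all of size `≥ 2`): `Φ ≥ 6272` (true minimum `6304`). -/
theorem Phi_ge_T1T2 (c : Fin 16 → ℤ) (B : ℤ) (hc : ∀ j, 2 ≤ c j) (hsum : ∑ j, c j = 40)
    (hB : 8 ≤ B) : 6272 ≤ Phi c B := by
  have h0 := Phi_ge_uncapped c B
  have h1 : ∑ j, loss (c j) ≤ ∑ j, (40 * c j - 64) :=
    Finset.sum_le_sum fun j _ => loss_le_two (c j) (hc j)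
  rw [sum_affine, hsum] at h1
  norm_num at h1
  linarith

/-- The T1 shapes (sixteen classes of size `≥ 1`): `Φ ≥ 5920` (true minimum `5968`). -/
theorem Phi_ge_T1 (c : Fin 16 → ℤ) (B : ℤ) (hc : ∀ j, 1 ≤ c j) (hsum : ∑ j, c j = 40)
    (hB : 8 ≤ B) : 5920 ≤ Phi c B := by
  have h0 := Phi_ge_uncapped c B
  have h1 : ∑ j, loss (c j) ≤ ∑ j, (36 * c j - 32) :=
    Finset.sum_le_sum fun j _ => loss_le (c j) (hc j)
  rw [sum_affine, hsum] at h1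
  norm_num at h1
  linarith

/-! ### Exact values at the extremal shapes (agree with `extfloor-toyPresB.json`) -/

/-- The global minimiser over all 37338 partitions of 40 (eight bottom classes): `(8,8,8,8,7,1)`. -/
theorem Phi_min_witness : Phi (![8, 8, 8, 8, 7, 1] : Fin 6 → ℤ) 8 = 5624 := by decide

/-- The only shape surviving the UNCAPPED floor, `(8,8,8,8,8)`: capped value `5736`. -/
theorem Phi_eight_five : Phi (![8, 8, 8, 8, 8] : Fin 5 → ℤ) 8 = 5736 := by decide

/-- Minimiser among the T1 shapes: `(8,8,8,4,1^12)`. -/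
theorem Phi_T1_min :
    Phi (![8, 8, 8, 4, 1, 1, 1, 1, 1, 1, 1, 1, 1, 1, 1, 1] : Fin 16 → ℤ) 8 = 5968 := by decide

/-- Minimiser among the T1 ∧ T2 shapes: `(8,4,2^14)`. -/
theorem Phi_T1T2_min :
    Phi (![8, 4, 2, 2, 2, 2, 2, 2, 2, 2, 2, 2, 2, 2, 2, 2] : Fin 16 → ℤ) 8 = 6304 := by decide

/-- The balanced shape `(3^8, 2^8)` of the g30 memo: `6432` (g30 crude floor was `3712`). -/
theorem Phi_balanced :
    Phi (![3, 3, 3, 3, 3, 3, 3, 3, 2, 2, 2, 2, 2, 2, 2, 2] : Fin 16 → ℤ) 8 = 6432 := by decide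

/-- The most lopsided T1 ∧ T2 shape `(10, 2^15)`: `6688`, the maximum over those shapes — still below
the all-`q` budget `8008 = C(16,6)` (`SeedChecker` all-`q` door), so the count is silent there. -/
theorem Phi_T1T2_max :
    Phi (![10, 2, 2, 2, 2, 2, 2, 2, 2, 2, 2, 2, 2, 2, 2, 2] : Fin 16 → ℤ) 8 = 6688 := by decide

theorem allq_silent : (6688 : ℤ) < 8008 := by norm_num

end Floor

end Summit.HodgeConjecture.HodgeConjecture.Cruxes.BlochSeedDiscOne.SeedCheckerThetaCover
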